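/-
VALUE = THEOREM (structure of the isometries of `𝔽_p³` fixing an anisotropic vector), NOT summit
progress (cell b2b-lgcu-borel, gen 24); the crux item stmt-MatrixMultiplication-14079 is untouched.
-/
import Mathlib
import Literature.NumberTheory.EllipticCurves.BinaryQuarticDiscriminantFpCountProofs
import Summits.MatrixMultiplication.MatrixMultiplication.Theorems.SubgroupIdentityDesigns.Negative.ReflectionClassPlane
import Summits.MatrixMultiplication.MatrixMultiplication.Theorems.SubgroupIdentityDesigns.Negative.DihedralUnipotent

/-!
# Isometries fixing an anisotropic vector are `R_z` or `R_z R_{w₁}` (`z ∈ x^⊥`)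

VALUE = THEOREM (generic in the prime `p`), NOT summit progress; the crux item
stmt-MatrixMultiplication-14079 is untouched and remains open.

Layer F4a of the all-`p` proof of the unified reflection-class certificate (ORACLE-g24 §G24-1 (L1),
§G24-2/3): the STABILISER STRUCTURE for an anisotropic `x`.  Let `q = Q(x) ≠ 0` and let
`w₁ = x × ω`, `w₂ = x × w₁` be the frame of `W = x^⊥` of `ReflectionClassPlane` (`Q(w₁) ≠ 0`).
For a matrix `g` with `gᵀ g = 1` and `g x = x`:

* `stab_structure` — there is an anisotropic `z ∈ W` with `g = R_z R_{w₁}` or `g = R_z`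
  (`R_z = NonsquareReflections.reflMat z`); `stab_proper` / `stab_improper` select the case by
  `det g = 1` / `det g = −1` (2-dimensional Cartan–Dieudonné, made explicit: in frame coordinates
  `g|_W` is `(α, β; −qβ, α)` or `(α, β; qβ, −α)` with `α² + qβ² = 1`, and the rational
  parametrisation `z = (1 ± α) w₁ ± β w₂` of the conic inverts it);
* `refl_frame` — reflections in frame coordinates; `mat_eq` — a matrix is determined by its values
  on `x, w₁, w₂`; `eq_smul_of_reflMat_eq` — `R_z = R_{z'}` forces `z' ∈ 𝔽_p^× z`.

This is the input "(CD2′)" of the orbit-sum assembly (F7): together with the sign character `ι`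
(`ReflectionClassIsoSign`) it identifies the stabiliser of an anisotropic `x` in a reflection
class group with `{R_z : z ∈ W of the class} ∪ {R_z R_{z₀} : z ∈ W, χ(Q z) = χ(Q z₀)}`.
HONEST SCOPE.  Linear algebra only; by itself it excludes nothing.
-/

set_option linter.dupNamespace false

open scoped BigOperators Matrix

namespace Summit.MatrixMultiplication.MatrixMultiplication.Theorems.SubgroupIdentityDesigns.Negative
namespace ReflectionClassStabAniso

open Summit.MatrixMultiplication.MatrixMultiplication.Theorems.LieRankDesigns.Negative (Mat)
open ReflectionClassCertificate (V)
open NonsquareReflections (reflMat reflMat_mulVec det_reflMat reflMat_mul_self)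
open ReflectionClassPlane (w₁ w₂ frame w₁_dot_x w₂_dot_x w₁_dot_w₂ w₂_dot_self frame_dot_x expand
  refl_apply)
open Literature.NumberTheory.EllipticCurves.BinaryQuartic (two_ne_zero_zmod)
open DihedralUnipotent (neg_one_ne_one)

variable {p : ℕ} [hp : Fact p.Prime]

/-! ## Isometries and the frame -/

/-- A matrix with `gᵀ g = 1` preserves the dot product. -/
theorem iso_dot {g : Mat p 3} (hg : gᵀ * g = 1) (v w : V p) :
    (g *ᵥ v) ⬝ᵥ (g *ᵥ w) = v ⬝ᵥ w := by
  rw [Matrix.dotProduct_mulVec, ← Matrix.vecMul_transpose, Matrix.vecMul_vecMul, hg,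
    Matrix.vecMul_one]

/-- An isometry fixing `x` maps `x^⊥` to itself. -/
theorem img_dot_x {g : Mat p 3} (hg : gᵀ * g = 1) {x : V p} (hgx : g *ᵥ x = x) {v : V p}
    (hv : v ⬝ᵥ x = 0) : (g *ᵥ v) ⬝ᵥ x = 0 := by
  conv_lhs => rw [← hgx]
  rw [iso_dot hg, hv]

section Frame

variable (x ω : V p)

/-- `w₁` in frame coordinates. -/
theorem w₁_eq_frame : w₁ x ω = frame x ω (1, 0) := by simp [frame]

/-- `w₂` in frame coordinates. -/
theorem w₂_eq_frame : w₂ x ω = frame x ω (0, 1) := by simp [frame]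

/-- Dot products in frame coordinates: `(u₀,v₀)·(u,v) = (u₀ u + q v₀ v) Q(w₁)`. -/
theorem frame_dot_frame (u₀ v₀ u v : ZMod p) :
    frame x ω (u₀, v₀) ⬝ᵥ frame x ω (u, v) =
      (u₀ * u + (x ⬝ᵥ x) * (v₀ * v)) * (w₁ x ω ⬝ᵥ w₁ x ω) := by
  simp only [frame, add_dotProduct, dotProduct_add, smul_dotProduct, dotProduct_smul, smul_eq_mul,
    w₁_dot_w₂, dotProduct_comm (w₂ x ω) (w₁ x ω), w₂_dot_self]
  ring

/-- **Reflections in frame coordinates**: `R_{(u₀,v₀)} (u,v) = (u − κ u₀, v − κ v₀)` with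
`κ = 2 ((u₀,v₀)·(u,v)) / Q(u₀,v₀)`. -/
theorem refl_frame (u₀ v₀ u v : ZMod p) :
    reflMat (frame x ω (u₀, v₀)) *ᵥ frame x ω (u, v) =
      frame x ω
        (u - 2 / (frame x ω (u₀, v₀) ⬝ᵥ frame x ω (u₀, v₀)) *
              (frame x ω (u₀, v₀) ⬝ᵥ frame x ω (u, v)) * u₀,
          v - 2 / (frame x ω (u₀, v₀) ⬝ᵥ frame x ω (u₀, v₀)) *
              (frame x ω (u₀, v₀) ⬝ᵥ frame x ω (u, v)) * v₀) := by
  rw [refl_apply]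
  generalize 2 / (frame x ω (u₀, v₀) ⬝ᵥ frame x ω (u₀, v₀)) *
      (frame x ω (u₀, v₀) ⬝ᵥ frame x ω (u, v)) = κ
  simp only [frame, sub_smul, smul_add, smul_smul]
  abel

/-- `R_{w₁} w₁ = −w₁ = (−1, 0)`. -/
theorem refl_w₁_w₁ (hQ : w₁ x ω ⬝ᵥ w₁ x ω ≠ 0) :
    reflMat (w₁ x ω) *ᵥ w₁ x ω = frame x ω (-1, 0) := by
  rw [refl_apply, div_mul_cancel₀ _ hQ]
  simp only [frame, neg_smul, one_smul, zero_smul, add_zero, two_smul]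
  abel

/-- `R_{w₁} w₂ = w₂ = (0, 1)`. -/
theorem refl_w₁_w₂ : reflMat (w₁ x ω) *ᵥ w₂ x ω = frame x ω (0, 1) := by
  rw [reflMat_mulVec _ _ (w₁_dot_w₂ x ω), w₂_eq_frame]

/-- `R_{w₁} x = x`. -/
theorem refl_w₁_x : reflMat (w₁ x ω) *ᵥ x = x := reflMat_mulVec _ _ (w₁_dot_x x ω)

/-- `R_z x = x` for a frame vector `z`. -/
theorem refl_frame_x (uv : ZMod p × ZMod p) : reflMat (frame x ω uv) *ᵥ x = x :=
  reflMat_mulVec _ _ (frame_dot_x uv)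

end Frame

section Basis

variable {x ω : V p}

/-- Every vector is `a x + u w₁ + v w₂` (`Q(x) ≠ 0`, `Q(w₁) ≠ 0`). -/
theorem exists_decomp (hq : x ⬝ᵥ x ≠ 0) (hQ : w₁ x ω ⬝ᵥ w₁ x ω ≠ 0) (v : V p) :
    ∃ a u t : ZMod p, v = a • x + (u • w₁ x ω + t • w₂ x ω) := by
  obtain ⟨z, hzdef⟩ : ∃ z : V p, z = v - ((v ⬝ᵥ x) / (x ⬝ᵥ x)) • x := ⟨_, rfl⟩
  have hzx : z ⬝ᵥ x = 0 := by
    rw [hzdef, sub_dotProduct, smul_dotProduct, smul_eq_mul, div_mul_cancel₀ _ hq, sub_self]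
  have hz := expand hq hQ hzx
  simp only [frame] at hz
  refine ⟨(v ⬝ᵥ x) / (x ⬝ᵥ x), (z ⬝ᵥ w₁ x ω) / (w₁ x ω ⬝ᵥ w₁ x ω),
    (z ⬝ᵥ w₂ x ω) / (w₂ x ω ⬝ᵥ w₂ x ω), ?_⟩
  rw [← hz, hzdef]
  abel

/-- **A matrix is determined by its values on `x, w₁, w₂`.** -/
theorem mat_eq (hq : x ⬝ᵥ x ≠ 0) (hQ : w₁ x ω ⬝ᵥ w₁ x ω ≠ 0) {M N : Mat p 3}
    (hx : M *ᵥ x = N *ᵥ x) (h1 : M *ᵥ w₁ x ω = N *ᵥ w₁ x ω)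
    (h2 : M *ᵥ w₂ x ω = N *ᵥ w₂ x ω) : M = N := by
  refine Matrix.ext_iff_mulVec.mpr fun v => ?_
  obtain ⟨a, u, t, rfl⟩ := exists_decomp hq hQ v
  simp only [Matrix.mulVec_add, Matrix.mulVec_smul, hx, h1, h2]

/-- `R_z = R_{z'}` for anisotropic `z` forces `z' = s z` with `s ≠ 0` (`p ≠ 2`). -/
theorem eq_smul_of_reflMat_eq (hp2 : p ≠ 2) {z z' : V p} (hz : z ⬝ᵥ z ≠ 0)
    (h : reflMat z = reflMat z') : ∃ s : ZMod p, s ≠ 0 ∧ z' = s • z := by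
  have h2 : (2 : ZMod p) ≠ 0 := two_ne_zero_zmod hp2
  have hz0 : z ≠ 0 := by rintro rfl; exact hz (dotProduct_zero 0)
  have h1 : reflMat z *ᵥ z = -z := by
    rw [refl_apply, div_mul_cancel₀ _ hz, two_smul]; abel
  rw [h, refl_apply] at h1
  -- `z − μ z' = −z`, so `μ z' = 2 z`
  have hμz : (2 / (z' ⬝ᵥ z') * (z' ⬝ᵥ z)) • z' = (2 : ZMod p) • z := by
    have h3 := sub_eq_iff_eq_add'.mp h1
    rw [two_smul]
    calc _ = (2 / (z' ⬝ᵥ z') * (z' ⬝ᵥ z)) • z' + -z + z := by abel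
      _ = z + z := by rw [← h3]
  have hμ : 2 / (z' ⬝ᵥ z') * (z' ⬝ᵥ z) ≠ 0 := by
    intro h0
    rw [h0, zero_smul] at hμz
    exact hz0 ((smul_eq_zero.mp hμz.symm).resolve_left h2)
  refine ⟨2 / (2 / (z' ⬝ᵥ z') * (z' ⬝ᵥ z)), div_ne_zero h2 hμ, ?_⟩
  rw [div_eq_mul_inv, mul_comm, ← smul_smul, ← hμz, smul_smul, inv_mul_cancel₀ hμ, one_smul]

end Basis

/-! ## Solving the isometry constraints -/

/-- The `2 × 2` isometry equations: if `α² + qβ² = 1`, `αγ + qβδ = 0`, `γ² + qδ² = q` (`q ≠ 0`)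
then `(γ, δ) = (−qβ, α)` (rotation) or `(γ, δ) = (qβ, −α)` (reflection). -/
theorem solve {F : Type*} [Field F] {q α β γ δ : F} (hq : q ≠ 0) (h1 : α ^ 2 + q * β ^ 2 = 1)
    (h2 : α * γ + q * β * δ = 0) (h3 : γ ^ 2 + q * δ ^ 2 = q) :
    (γ = -(q * β) ∧ δ = α) ∨ (γ = q * β ∧ δ = -α) := by
  have hδ : δ ^ 2 = α ^ 2 := by
    have h : q * (δ ^ 2 - α ^ 2) = 0 := by
      linear_combination (-(q * δ ^ 2)) * h1 + (q * β * δ - α * γ) * h2 + α ^ 2 * h3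
    exact sub_eq_zero.mp ((mul_eq_zero.mp h).resolve_left hq)
  by_cases hα : α = 0
  · have hδ0 : δ = 0 := by rw [hα] at hδ; simpa using hδ
    have hβ : q * β ^ 2 = 1 := by rw [hα] at h1; simpa using h1
    have hγ : (γ - q * β) * (γ + q * β) = 0 := by
      rw [hδ0] at h3
      linear_combination h3 - q * hβ
    rcases mul_eq_zero.mp hγ with h | h
    · exact Or.inr ⟨sub_eq_zero.mp h, by rw [hδ0, hα, neg_zero]⟩
    · exact Or.inl ⟨eq_neg_of_add_eq_zero_left h, by rw [hδ0, hα]⟩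
  · rcases eq_or_eq_neg_of_sq_eq_sq δ α hδ with hd | hd
    · refine Or.inl ⟨?_, hd⟩
      have h : α * (γ + q * β) = 0 := by rw [hd] at h2; linear_combination h2
      linear_combination (mul_eq_zero.mp h).resolve_left hα
    · refine Or.inr ⟨?_, hd⟩
      have h : α * (γ - q * β) = 0 := by rw [hd] at h2; linear_combination h2
      linear_combination (mul_eq_zero.mp h).resolve_left hα

/-! ## The structure theorem -/

section Stab

variable {x ω : V p} {g : Mat p 3}

/-- Frame coordinates of `g w₁`, `g w₂` and the three isometry constraints. -/
theorem constraints (hq : x ⬝ᵥ x ≠ 0) (hQ : w₁ x ω ⬝ᵥ w₁ x ω ≠ 0) (hg : gᵀ * g = 1)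
    (hgx : g *ᵥ x = x) :
    ∃ α β γ δ : ZMod p, g *ᵥ w₁ x ω = frame x ω (α, β) ∧ g *ᵥ w₂ x ω = frame x ω (γ, δ) ∧
      α ^ 2 + (x ⬝ᵥ x) * β ^ 2 = 1 ∧ α * γ + (x ⬝ᵥ x) * β * δ = 0 ∧
      γ ^ 2 + (x ⬝ᵥ x) * δ ^ 2 = x ⬝ᵥ x := by
  obtain ⟨α, β, ha⟩ : ∃ α β : ZMod p, g *ᵥ w₁ x ω = frame x ω (α, β) :=
    ⟨_, _, expand hq hQ (img_dot_x hg hgx (w₁_dot_x x ω))⟩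
  obtain ⟨γ, δ, hb⟩ : ∃ γ δ : ZMod p, g *ᵥ w₂ x ω = frame x ω (γ, δ) :=
    ⟨_, _, expand hq hQ (img_dot_x hg hgx (w₂_dot_x x ω))⟩
  refine ⟨α, β, γ, δ, ha, hb, ?_, ?_, ?_⟩
  · have h := iso_dot hg (w₁ x ω) (w₁ x ω)
    rw [ha, frame_dot_frame] at h
    linear_combination mul_right_cancel₀ hQ (h.trans (one_mul _).symm)
  · have h := iso_dot hg (w₁ x ω) (w₂ x ω)
    rw [ha, hb, frame_dot_frame, w₁_dot_w₂] at h
    linear_combination (mul_eq_zero.mp h).resolve_right hQ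
  · have h := iso_dot hg (w₂ x ω) (w₂ x ω)
    rw [hb, frame_dot_frame, w₂_dot_self] at h
    linear_combination mul_right_cancel₀ hQ h

/-- Rotation data `(α, β; −qβ, α)` with `α ≠ −1` is realised by `R_z R_{w₁}`, `z = (1+α, β)`. -/
theorem rot_eval (hp2 : p ≠ 2) (hQ : w₁ x ω ⬝ᵥ w₁ x ω ≠ 0) {α β : ZMod p}
    (h1 : α ^ 2 + (x ⬝ᵥ x) * β ^ 2 = 1) (hα : 1 + α ≠ 0) :
    frame x ω (1 + α, β) ⬝ᵥ frame x ω (1 + α, β) ≠ 0 ∧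
    (reflMat (frame x ω (1 + α, β)) * reflMat (w₁ x ω)) *ᵥ w₁ x ω = frame x ω (α, β) ∧
    (reflMat (frame x ω (1 + α, β)) * reflMat (w₁ x ω)) *ᵥ w₂ x ω =
      frame x ω (-((x ⬝ᵥ x) * β), α) := by
  have h2 : (2 : ZMod p) ≠ 0 := two_ne_zero_zmod hp2
  have hzz : frame x ω (1 + α, β) ⬝ᵥ frame x ω (1 + α, β) =
      2 * (1 + α) * (w₁ x ω ⬝ᵥ w₁ x ω) := by
    rw [frame_dot_frame]; linear_combination (w₁ x ω ⬝ᵥ w₁ x ω) * h1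
  have hz : frame x ω (1 + α, β) ⬝ᵥ frame x ω (1 + α, β) ≠ 0 := by
    rw [hzz]; exact mul_ne_zero (mul_ne_zero h2 hα) hQ
  refine ⟨hz, ?_, ?_⟩
  · have hκ : 2 / (frame x ω (1 + α, β) ⬝ᵥ frame x ω (1 + α, β)) *
        (frame x ω (1 + α, β) ⬝ᵥ frame x ω (-1, 0)) = -1 := by
      rw [div_mul_eq_mul_div, div_eq_iff hz, hzz, frame_dot_frame]; ring
    rw [← Matrix.mulVec_mulVec, refl_w₁_w₁ x ω hQ, refl_frame, hκ]
    congr 1; ext <;> ring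
  · have hκ : 2 / (frame x ω (1 + α, β) ⬝ᵥ frame x ω (1 + α, β)) *
        (frame x ω (1 + α, β) ⬝ᵥ frame x ω (0, 1)) = (x ⬝ᵥ x) * β / (1 + α) := by
      rw [div_mul_eq_mul_div, div_eq_div_iff hz hα, hzz, frame_dot_frame]; ring
    rw [← Matrix.mulVec_mulVec, refl_w₁_w₂ x ω, refl_frame, hκ]
    have h : x ⬝ᵥ x * β / (1 + α) * β = 1 - α := by
      rw [div_mul_eq_mul_div, div_eq_iff hα]; linear_combination h1
    congr 1; ext
    · rw [div_mul_cancel₀ _ hα]; ring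
    · rw [h]; ring

/-- Reflection data `(α, β; qβ, −α)` with `α ≠ 1` is realised by `R_z`, `z = (1−α, −β)`. -/
theorem ref_eval (hp2 : p ≠ 2) (hQ : w₁ x ω ⬝ᵥ w₁ x ω ≠ 0) {α β : ZMod p}
    (h1 : α ^ 2 + (x ⬝ᵥ x) * β ^ 2 = 1) (hα : 1 - α ≠ 0) :
    frame x ω (1 - α, -β) ⬝ᵥ frame x ω (1 - α, -β) ≠ 0 ∧
    reflMat (frame x ω (1 - α, -β)) *ᵥ w₁ x ω = frame x ω (α, β) ∧
    reflMat (frame x ω (1 - α, -β)) *ᵥ w₂ x ω = frame x ω ((x ⬝ᵥ x) * β, -α) := by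
  have h2 : (2 : ZMod p) ≠ 0 := two_ne_zero_zmod hp2
  have hzz : frame x ω (1 - α, -β) ⬝ᵥ frame x ω (1 - α, -β) =
      2 * (1 - α) * (w₁ x ω ⬝ᵥ w₁ x ω) := by
    rw [frame_dot_frame]; linear_combination (w₁ x ω ⬝ᵥ w₁ x ω) * h1
  have hz : frame x ω (1 - α, -β) ⬝ᵥ frame x ω (1 - α, -β) ≠ 0 := by
    rw [hzz]; exact mul_ne_zero (mul_ne_zero h2 hα) hQ
  refine ⟨hz, ?_, ?_⟩
  · have hκ : 2 / (frame x ω (1 - α, -β) ⬝ᵥ frame x ω (1 - α, -β)) *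
        (frame x ω (1 - α, -β) ⬝ᵥ frame x ω (1, 0)) = 1 := by
      rw [div_mul_eq_mul_div, div_eq_iff hz, hzz, frame_dot_frame]; ring
    rw [w₁_eq_frame x ω, refl_frame, hκ]
    congr 1; ext <;> ring
  · have hκ : 2 / (frame x ω (1 - α, -β) ⬝ᵥ frame x ω (1 - α, -β)) *
        (frame x ω (1 - α, -β) ⬝ᵥ frame x ω (0, 1)) = -((x ⬝ᵥ x) * β / (1 - α)) := by
      rw [div_mul_eq_mul_div, neg_div', div_eq_div_iff hz hα, hzz, frame_dot_frame]; ring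
    rw [w₂_eq_frame x ω, refl_frame, hκ]
    have h : x ⬝ᵥ x * β / (1 - α) * β = 1 + α := by
      rw [div_mul_eq_mul_div, div_eq_iff hα]; linear_combination h1
    congr 1; ext
    · rw [neg_mul, div_mul_cancel₀ _ hα]; ring
    · rw [neg_mul_neg, h]; ring

/-- The degenerate data `α = ±1, β = 0`: `R_{w₂}` acts on the frame by `(1, 0; 0, −1)`. -/
theorem w₂_eval (hp2 : p ≠ 2) (hq : x ⬝ᵥ x ≠ 0) (hQ : w₁ x ω ⬝ᵥ w₁ x ω ≠ 0) :
    frame x ω (0, 1) ⬝ᵥ frame x ω (0, 1) ≠ 0 ∧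
    reflMat (frame x ω (0, 1)) *ᵥ frame x ω (1, 0) = frame x ω (1, 0) ∧
    reflMat (frame x ω (0, 1)) *ᵥ frame x ω (-1, 0) = frame x ω (-1, 0) ∧
    reflMat (frame x ω (0, 1)) *ᵥ frame x ω (0, 1) = frame x ω (0, -1) := by
  have h2 : (2 : ZMod p) ≠ 0 := two_ne_zero_zmod hp2
  have hzz : frame x ω (0, 1) ⬝ᵥ frame x ω (0, 1) = (x ⬝ᵥ x) * (w₁ x ω ⬝ᵥ w₁ x ω) := by
    rw [frame_dot_frame]; ring
  have hz : frame x ω (0, 1) ⬝ᵥ frame x ω (0, 1) ≠ 0 := by rw [hzz]; exact mul_ne_zero hq hQ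
  refine ⟨hz, ?_, ?_, ?_⟩
  · rw [refl_frame]; congr 1; ext <;> simp [frame_dot_frame]
  · rw [refl_frame]; congr 1; ext <;> simp [frame_dot_frame]
  · have hκ : 2 / (frame x ω (0, 1) ⬝ᵥ frame x ω (0, 1)) *
        (frame x ω (0, 1) ⬝ᵥ frame x ω (0, 1)) = 2 := div_mul_cancel₀ _ hz
    rw [refl_frame, hκ]; congr 1; ext <;> ring

/-- **Stabiliser structure (anisotropic `x`).**  An isometry `g` (`gᵀ g = 1`) with `g x = x` is
`R_z R_{w₁}` or `R_z` for an anisotropic `z ∈ x^⊥` (`p ≠ 2`, `Q(x) ≠ 0`, `Q(w₁) ≠ 0`). -/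
theorem stab_structure (hp2 : p ≠ 2) (hq : x ⬝ᵥ x ≠ 0) (hQ : w₁ x ω ⬝ᵥ w₁ x ω ≠ 0)
    (hg : gᵀ * g = 1) (hgx : g *ᵥ x = x) :
    ∃ z : V p, z ⬝ᵥ x = 0 ∧ z ⬝ᵥ z ≠ 0 ∧
      (g = reflMat z * reflMat (w₁ x ω) ∨ g = reflMat z) := by
  obtain ⟨α, β, γ, δ, ha, hb, h1, h2, h3⟩ := constraints hq hQ hg hgx
  rcases solve hq h1 h2 h3 with ⟨hγ, hδ⟩ | ⟨hγ, hδ⟩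
  · -- rotation
    by_cases hα : 1 + α = 0
    · have hα' : α = -1 := by linear_combination hα
      have hβ : β = 0 := by
        have h : (x ⬝ᵥ x) * β ^ 2 = 0 := by rw [hα'] at h1; linear_combination h1
        exact pow_eq_zero_iff two_ne_zero |>.mp ((mul_eq_zero.mp h).resolve_left hq)
      obtain ⟨hz, he1, he2, he3⟩ := w₂_eval (x := x) (ω := ω) hp2 hq hQ
      refine ⟨frame x ω (0, 1), frame_dot_x _, hz, Or.inl (mat_eq hq hQ ?_ ?_ ?_)⟩
      · rw [hgx, ← Matrix.mulVec_mulVec, refl_w₁_x, refl_frame_x]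
      · rw [ha, ← Matrix.mulVec_mulVec, refl_w₁_w₁ x ω hQ, he2, hα', hβ]
      · rw [hb, ← Matrix.mulVec_mulVec, refl_w₁_w₂ x ω, he3, hγ, hδ, hα', hβ, mul_zero, neg_zero]
    · obtain ⟨hz, he1, he2⟩ := rot_eval hp2 hQ h1 hα
      refine ⟨frame x ω (1 + α, β), frame_dot_x _, hz, Or.inl (mat_eq hq hQ ?_ ?_ ?_)⟩
      · rw [hgx, ← Matrix.mulVec_mulVec, refl_w₁_x, refl_frame_x]
      · rw [ha, he1]
      · rw [hb, he2, hγ, hδ]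
  · -- reflection
    by_cases hα : 1 - α = 0
    · have hα' : α = 1 := by linear_combination -hα
      have hβ : β = 0 := by
        have h : (x ⬝ᵥ x) * β ^ 2 = 0 := by rw [hα'] at h1; linear_combination h1
        exact pow_eq_zero_iff two_ne_zero |>.mp ((mul_eq_zero.mp h).resolve_left hq)
      obtain ⟨hz, he1, he2, he3⟩ := w₂_eval (x := x) (ω := ω) hp2 hq hQ
      refine ⟨frame x ω (0, 1), frame_dot_x _, hz, Or.inr (mat_eq hq hQ ?_ ?_ ?_)⟩
      · rw [hgx, refl_frame_x]
      · rw [ha, w₁_eq_frame x ω, he1, hα', hβ]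
      · rw [hb, w₂_eq_frame x ω, he3, hγ, hδ, hα', hβ, mul_zero]
    · obtain ⟨hz, he1, he2⟩ := ref_eval hp2 hQ h1 hα
      refine ⟨frame x ω (1 - α, -β), frame_dot_x _, hz, Or.inr (mat_eq hq hQ ?_ ?_ ?_)⟩
      · rw [hgx, refl_frame_x]
      · rw [ha, he1]
      · rw [hb, he2, hγ, hδ]

/-- **Proper stabiliser**: `gᵀ g = 1`, `g x = x`, `det g = 1` ⇒ `g = R_z R_{w₁}`, `z ∈ x^⊥`
anisotropic. -/
theorem stab_proper (hp2 : p ≠ 2) (hq : x ⬝ᵥ x ≠ 0) (hQ : w₁ x ω ⬝ᵥ w₁ x ω ≠ 0)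
    (hg : gᵀ * g = 1) (hgx : g *ᵥ x = x) (hdet : g.det = 1) :
    ∃ z : V p, z ⬝ᵥ x = 0 ∧ z ⬝ᵥ z ≠ 0 ∧ g = reflMat z * reflMat (w₁ x ω) := by
  obtain ⟨z, hzx, hz, h | h⟩ := stab_structure hp2 hq hQ hg hgx
  · exact ⟨z, hzx, hz, h⟩
  · exfalso
    rw [h, det_reflMat z hz] at hdet
    exact neg_one_ne_one hp2 hdet

/-- **Improper stabiliser** ("CD2′"): `gᵀ g = 1`, `g x = x`, `det g = −1` ⇒ `g = R_z`, `z ∈ x^⊥`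
anisotropic. -/
theorem stab_improper (hp2 : p ≠ 2) (hq : x ⬝ᵥ x ≠ 0) (hQ : w₁ x ω ⬝ᵥ w₁ x ω ≠ 0)
    (hg : gᵀ * g = 1) (hgx : g *ᵥ x = x) (hdet : g.det = -1) :
    ∃ z : V p, z ⬝ᵥ x = 0 ∧ z ⬝ᵥ z ≠ 0 ∧ g = reflMat z := by
  obtain ⟨z, hzx, hz, h | h⟩ := stab_structure hp2 hq hQ hg hgx
  · exfalso
    rw [h, Matrix.det_mul, det_reflMat z hz, det_reflMat _ hQ] at hdet
    exact neg_one_ne_one hp2 (by linear_combination -hdet)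
  · exact ⟨z, hzx, hz, h⟩

end Stab

end ReflectionClassStabAniso
end Summit.MatrixMultiplication.MatrixMultiplication.Theorems.SubgroupIdentityDesigns.Negative
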